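import Summits.BirchSwinnertonDyer.BirchSwinnertonDyer.Theses.PlecticLegs
import Literature.NumberTheory.EllipticCurves.Selmer
import Literature.NumberTheory.EllipticCurves.GaloisAction
import Literature.NumberTheory.EllipticCurves.SelmerCorankHolds
import Literature.NumberTheory.EllipticCurves.BSDSha
import Literature.NumberTheory.EllipticCurves.BSDSelmerParityDokchitserProofs
import HarnessLib

/-!
# Crux `PlecticLegs.PlecticPointsLB` (stmt-BirchSwinnertonDyer-17518), line `Sketch`, stub D `stub_points` —
# what the wall stub reduces to (lead a1, 2026-08-17)

The registered stub D of `Cruxes/PlecticPointsLB/Lines/Sketch.lean` (= stub D of `Lines/selmer_ladder.lean`) reads: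
for `F` totally real of degree `d ≥ 2` and `V/F` elliptic with `ord_{s=1} L(V/F,s) = d`, there is an ADMISSIBLE prime
`p` (`5 ≤ p`, `p ∤ disc F`, `ρ̄_{V,p}` irreducible, good ordinary above `p` — read on Mathlib's `localPolynomial`) with
`corank_{ℤ_p} Sel_{p^∞}(V/F) ≤ rank_ℤ V(F)`.

This file records, sorry-free, what D hinges on:

* `selmerCorank_le_mordellWeilRank_of_finite_sha` — if `Ш(V/F)` is finite then `s_p ≤ rank` at EVERY prime `p`
  (corank identity `s_p = rank + corank Ш[p^∞]`, tree theorem `selmerCorank_eq_mordellWeilRank_add_holds`, and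
  `zpCorank` of a finite group is `0`);
* `stub_points_of_shaFinite_of_admissibleSupply` — D follows from the finiteness of `Ш` over totally real fields
  (the EXISTING named conjecture `Literature.NumberTheory.EllipticCurves.ShaFiniteConjectureNF`, Tate 1974 Conj. 1)
  together with the SUPPLY of one admissible prime for every elliptic curve over a totally real field (kept as an
  explicit hypothesis: true by Serre 1972 §4 for non-CM curves and by Deuring's criterion for CM curves — `p` split in
  the CM field — but not in the tree); the plectic-regime hypotheses `2 ≤ d`, `r_an = d` are not used by this road,
  which is the point: D is the Selmer-versus-Mordell–Weil wall (`Literature.Barriers.BirchSwinnertonDyer.SelmerRankBarrier`,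
  narrow form), independent of the analytic regime;
* `stub_points_of_shaCorank` — the sharper, regime-sensitive form any POINT construction would deliver: it suffices
  to produce, in the plectic regime, one admissible `p` with `corank Ш(V/F)[p^∞] = 0`.
-/

set_option linter.dupNamespace false -- single-conjunct summit: Sub = Summit (D-0017)

open NumberField IsDedekindDomain

namespace Summit.BirchSwinnertonDyer.BirchSwinnertonDyer.Theorems

open Literature.NumberTheory.EllipticCurves

/-- If `Ш(V/K)` is finite then `corank_{ℤ_p} Sel_{p^∞}(V/K) ≤ rank_ℤ V(K)` (indeed `=`) at every prime `p`:
`s_p = rank + corank Ш[p^∞]` (`selmerCorank_eq_mordellWeilRank_add_holds`) and a finite group has `ℤ_p`-corank `0`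
(`zpCorank_eq_zero_of_finite`, applied to the `p`-primary component of `Ш`). -/
theorem selmerCorank_le_mordellWeilRank_of_finite_sha {K : Type} [Field K] [NumberField K]
    (V : WeierstrassCurve K) [V.IsElliptic] (hfin : Finite V.sha) (p : ℕ) [Fact p.Prime] :
    V.selmerCorank p ≤ V.mordellWeilRank := by
  haveI : Finite (AddCommGroup.primaryComponent V.sha p) := Subtype.finite
  have h0 : V.shaCorank p = 0 := zpCorank_eq_zero_of_finite _ p
  have hs := V.selmerCorank_eq_mordellWeilRank_add_holds p
  omega

/-- **Stub D from Ш-finiteness and an admissible-prime supply.** If `Ш(V/F)` is finite for every elliptic curve over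
every (totally real) number field (`ShaFiniteConjectureNF`, Tate 1974 Conj. 1 — an open conjecture, taken as a
hypothesis) and every elliptic curve over a totally real field has an admissible prime (hypothesis `hSupply`), then
the registered stub `stub_points` holds — with the plectic-regime hypotheses unused. -/
theorem stub_points_of_shaFinite_of_admissibleSupply
    (hSha : ∀ (K : Type) [Field K] [NumberField K], NumberField.IsTotallyReal K → ShaFiniteConjectureNF K)
    (hSupply : ∀ (F : Type) [Field F] [NumberField F] [NumberField.IsTotallyReal F] (V : WeierstrassCurve F)
      [V.IsElliptic], ∃ (p : ℕ) (_ : Fact p.Prime), 5 ≤ p ∧ ¬ ((p : ℤ) ∣ NumberField.discr F) ∧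
        V.HasIrreducibleModPGaloisRep p ∧
        (∀ 𝔭 : HeightOneSpectrum (𝓞 F), (p : 𝓞 F) ∈ 𝔭.asIdeal →
          ((V.baseChange (𝔭.adicCompletion F)).localPolynomial (𝔭.adicCompletionIntegers F)).natDegree = 2 ∧
          ¬ (p : ℤ) ∣ ((V.baseChange (𝔭.adicCompletion F)).localPolynomial
            (𝔭.adicCompletionIntegers F)).coeff 1)) :
    ∀ (F : Type) [Field F] [NumberField F] [NumberField.IsTotallyReal F] (V : WeierstrassCurve F)
      [V.IsElliptic], 2 ≤ Module.finrank ℚ F → V.analyticRank = Module.finrank ℚ F →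
      ∃ (p : ℕ) (_ : Fact p.Prime), 5 ≤ p ∧ ¬ ((p : ℤ) ∣ NumberField.discr F) ∧
        V.HasIrreducibleModPGaloisRep p ∧
        (∀ 𝔭 : HeightOneSpectrum (𝓞 F), (p : 𝓞 F) ∈ 𝔭.asIdeal →
          ((V.baseChange (𝔭.adicCompletion F)).localPolynomial (𝔭.adicCompletionIntegers F)).natDegree = 2 ∧
          ¬ (p : ℤ) ∣ ((V.baseChange (𝔭.adicCompletion F)).localPolynomial
            (𝔭.adicCompletionIntegers F)).coeff 1) ∧
        V.selmerCorank p ≤ V.mordellWeilRank := by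
  intro F _ _ hF V hV _ _
  obtain ⟨p, hp, h5, hdisc, hirr, hord⟩ := hSupply F V
  haveI := hp
  exact ⟨p, hp, h5, hdisc, hirr, hord,
    selmerCorank_le_mordellWeilRank_of_finite_sha V (hSha F hF V hV) p⟩

/-- **Stub D from Ш[p^∞]-cotorsion at one admissible prime in the plectic regime** — the regime-sensitive form a
plectic point/class construction would have to deliver (`corank Ш(V/F)[p^∞] = 0` in place of `s_p ≤ rank`; the two
are equivalent by the corank identity, cf. `Literature.Barriers.BirchSwinnertonDyer.shaCorank_eq_zero_iff_selmerCorank_le_holds`). -/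
theorem stub_points_of_shaCorank
    (h : ∀ (F : Type) [Field F] [NumberField F] [NumberField.IsTotallyReal F] (V : WeierstrassCurve F)
      [V.IsElliptic], 2 ≤ Module.finrank ℚ F → V.analyticRank = Module.finrank ℚ F →
      ∃ (p : ℕ) (_ : Fact p.Prime), 5 ≤ p ∧ ¬ ((p : ℤ) ∣ NumberField.discr F) ∧
        V.HasIrreducibleModPGaloisRep p ∧
        (∀ 𝔭 : HeightOneSpectrum (𝓞 F), (p : 𝓞 F) ∈ 𝔭.asIdeal →
          ((V.baseChange (𝔭.adicCompletion F)).localPolynomial (𝔭.adicCompletionIntegers F)).natDegree = 2 ∧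
          ¬ (p : ℤ) ∣ ((V.baseChange (𝔭.adicCompletion F)).localPolynomial
            (𝔭.adicCompletionIntegers F)).coeff 1) ∧
        V.shaCorank p = 0) :
    ∀ (F : Type) [Field F] [NumberField F] [NumberField.IsTotallyReal F] (V : WeierstrassCurve F)
      [V.IsElliptic], 2 ≤ Module.finrank ℚ F → V.analyticRank = Module.finrank ℚ F →
      ∃ (p : ℕ) (_ : Fact p.Prime), 5 ≤ p ∧ ¬ ((p : ℤ) ∣ NumberField.discr F) ∧
        V.HasIrreducibleModPGaloisRep p ∧
        (∀ 𝔭 : HeightOneSpectrum (𝓞 F), (p : 𝓞 F) ∈ 𝔭.asIdeal →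
          ((V.baseChange (𝔭.adicCompletion F)).localPolynomial (𝔭.adicCompletionIntegers F)).natDegree = 2 ∧
          ¬ (p : ℤ) ∣ ((V.baseChange (𝔭.adicCompletion F)).localPolynomial
            (𝔭.adicCompletionIntegers F)).coeff 1) ∧
        V.selmerCorank p ≤ V.mordellWeilRank := by
  intro F _ _ _ V _ hd hran
  obtain ⟨p, hp, h5, hdisc, hirr, hord, hsha⟩ := h F V hd hran
  haveI := hp
  have hs := V.selmerCorank_eq_mordellWeilRank_add_holds p
  exact ⟨p, hp, h5, hdisc, hirr, hord, by omega⟩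

end Summit.BirchSwinnertonDyer.BirchSwinnertonDyer.Theorems
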